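import Literature.MathematicalPhysics.QuantumFieldTheory.Balaban1983to89.MissingProofs
import HarnessLib

/-!
# NE7ApexFrozenDefs — the OBJECTS of the frozen witness: the two-element gauge group `Z2 = {±1}` with its uniform Haar data, and
# the plaquette scheme on the `d = 4` tori at the frozen couplings `β_K = n_K + K` (definitions + their letters; reviewed)

HONEST FRAMING (page 1).  Cell `pub-balaban`, rung (B)+1 sub-cell t4, lineage `b2b-balaban-t4-ne7-p1`, generation 31 (CRUX PROVER
NE7 #1, ruling e34b3e0c (2)); skeleton `t4/skeletons/NE7-CRUX-R1.md` v1.7.10.  FIXED FINITE T⁴; continuum `SU(N)` Yang–Mills on T⁴ ⇐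
BetaPertH ∧ nine spine estimates (0∕9 proved); BetaPertH ⇐ (D1) ∧ (D4) ∧ CAP+tail; G-an2-4 gates asym, D1 and NE2∕3∕4; NOT infinite
volume, NOT mass gap, NOT Clay.  The crux NE7 (node U5 = `T4ApexVariance.StringwiseMatching` for Bałaban's scheme) and the apex U0
(`Missing.HasContinuumLimit`) are NOT PRINTED and NOT PROVED, and NOTHING below bears on them: this is [our toy] — an HONEST lattice
gauge theory (Wilson's action, product Haar measure, gauge-invariant observables of `Setup` ∕ `Missing`) in the one regime where an
elementary estimate decides everything, a FINITE gauge group at FROZEN couplings.  Its value: every inhabitant of the two apex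
predicates this owner could find in the tree (gen 31 search of the `HasContinuumLimit` ∕ `StringwiseMatching` conclusions:
`T4VarianceMatching`, `T4PathMeanHybrid`, `NE7Pairwise*`, `NE7LawLevel*`, `CovariantMean*`, …) is CONDITIONAL on a rate hypothesis, and
the only unconditional statement about a concrete lattice gauge theory is compactness (`WilsonLoopLimit`: "nothing about the
dynamics of the lattice theory is used anywhere"); the four modules `NE7ApexFrozenPeierls` ∕ `NE7ApexFrozenScheme` (theorems, any finite group) and `NE7ApexFrozenDefs` ∕ `NE7ApexFrozenWitness` (the `Z2` plaquette instance)
inhabit BOTH predicates OUTRIGHT by a Peierls-type energy–entropy bound under the Gibbs measure — a NON-VACUITY WITNESS of the apex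
SHAPES by a lattice gauge theory and a calibration family for apex-level sockets.  The regime is DEGENERATE (no asymptotic freedom;
the limit theory is the trivial flat sector, every string expectation tends to `1`); NOT `SU(N)`, NOT Bałaban's renormalisation
group, NOT NE7, NOT summit progress.

THIS MODULE (definitions; [folklore] throughout).
§1 `Z2 := ℤˣ` as a FRESH type (so its instances meet no other instance on `ℤˣ`): `CommGroup`, `Fintype` (`card_eq : |Z2| = 2`),
   `GaugeGroup` with `reTr(±1) = ±1`, `dist1 g = |reTr g − 1|` (the eleven axioms checked by cases), TRACE GAP `Δ = 2` (`Z2.gap`: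
   `reTr g < 1 ⇒ 2 ≤ 1 − reTr g`), the discrete measurable structure, `RegularGaugeGroup`, and `HaarData` := the uniform measure
   `½·count` (`unif`; probability, left∕right∕inversion invariance checked on singletons via `Measure.ext_iff_singleton`).
§2 `plaquetteScheme G L hL m β pl : Missing.TorusScheme G O` for ANY gauge group: tori `Missing.params4 L m K` (`d = 4`; `2L^{m+K} → ∞`
   sites per direction, `sitesPerDir_params4_tendsto`), couplings `β`, observables = the plaquette variables `Re tr U(∂p)` at chosen
   plaquettes `pl K o` (`1 × 1` Wilson loops; bounded by `1` on a regular group, `plaquetteScheme_abs_le`); the FROZEN COUPLINGS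
   `frozenBeta L hL m K = n_K + K ≥ 0` (`n_K` = positively oriented bonds of the `K`-th torus).
Consumer: `NE7ApexFrozenWitness` (both apex predicates for `plaquetteScheme Z2 L hL m (frozenBeta L hL m) pl`, no hypothesis, through the
def-free scheme-level theorems of `NE7ApexFrozenScheme`).  NOT `SU(N)`; NOT NE7.
-/

set_option autoImplicit false

noncomputable section

open MeasureTheory Filter Topology ProbabilityTheory
open scoped BigOperators ENNReal

namespace Summit.QuantumFields.BalabanUV.T4Continuum.NE7ApexFrozenDefs

open Literature.MathematicalPhysics.QuantumFieldTheory.Balaban1983to89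
open Missing (TorusScheme params4)

/-! ## §1 The two-element gauge group `Z2 = {±1}` -/

/-- The two-element group `{±1}` (the units of `ℤ`) as a FRESH type, so that the instances below stay local to this witness and
meet no other instance on `ℤˣ`. [folklore] -/
def Z2 : Type := ℤˣ

namespace Z2

/-- The group structure of `ℤˣ`. [folklore] -/
instance : CommGroup Z2 := inferInstanceAs (CommGroup ℤˣ)
/-- Two elements. [folklore] -/
instance : Fintype Z2 := inferInstanceAs (Fintype ℤˣ)
/-- Decidable equality of `ℤˣ`. [folklore] -/
instance : DecidableEq Z2 := inferInstanceAs (DecidableEq ℤˣ)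

/-- The identification with `ℤˣ`. [folklore] -/
def toUnits (g : Z2) : ℤˣ := g

/-- The "normalised trace" of `±1` is `±1`. [folklore] -/
def tr (g : Z2) : ℝ := ((toUnits g : ℤ) : ℝ)

/-- Every element is `1` or `−1`, with traces `1`, `−1`. [folklore] -/
theorem eq_one_or (g : Z2) : (g = 1 ∧ tr g = 1) ∨ (tr g = -1) := by
  rcases Int.units_eq_one_or (toUnits g) with h | h
  · left
    exact ⟨h, by simp [tr, h]⟩
  · right
    simp [tr, h]

/-- `tr 1 = 1`. [folklore] -/
theorem tr_one : tr 1 = 1 := by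
  have h : toUnits 1 = 1 := rfl
  simp [tr, h]

/-- `tr` is multiplicative. [folklore] -/
theorem tr_mul (g h : Z2) : tr (g * h) = tr g * tr h := by
  have hm : toUnits (g * h) = toUnits g * toUnits h := rfl
  simp only [tr, hm, Units.val_mul, Int.cast_mul]

/-- `tr g⁻¹ = tr g` (every element is its own inverse). [folklore] -/
theorem tr_inv (g : Z2) : tr g⁻¹ = tr g := by
  have : (toUnits g)⁻¹ = toUnits g := Int.units_inv_eq_self _
  show (((toUnits g)⁻¹ : ℤˣ) : ℤ) = ((toUnits g : ℤ) : ℝ)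
  rw [this]

/-- `tr g ≤ 1`. [folklore] -/
theorem tr_le_one (g : Z2) : tr g ≤ 1 := by
  rcases eq_one_or g with ⟨-, h⟩ | h
  · rw [h]
  · rw [h]; norm_num

/-- `|tr g| ≤ 1`. [folklore] -/
theorem abs_tr_le_one (g : Z2) : |tr g| ≤ 1 := by
  rcases eq_one_or g with ⟨-, h⟩ | h
  · rw [h, abs_one]
  · rw [h, abs_neg, abs_one]

/-- `Z2` as a `GaugeGroup`: `dist1 g = |tr g − 1|`, `reTr = tr`. [folklore] -/
instance instGaugeGroup : GaugeGroup Z2 where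
  dist1 g := |tr g - 1|
  reTr := tr
  dist1_nonneg g := abs_nonneg _
  dist1_one := by simp [tr_one]
  dist1_inv g := by rw [tr_inv]
  dist1_conj g h := by rw [mul_comm h g, mul_assoc, mul_inv_cancel, mul_one]
  dist1_mul_le g h := by
    rw [tr_mul]
    rcases eq_one_or g with ⟨-, hg⟩ | hg <;> rcases eq_one_or h with ⟨-, hh⟩ | hh
    all_goals rw [hg, hh]; norm_num
  reTr_one := tr_one
  reTr_le_one := tr_le_one
  reTr_inv := tr_inv
  reTr_conj g h := by rw [mul_comm h g, mul_assoc, mul_inv_cancel, mul_one]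

/-- THE TRACE GAP of `Z2`: `reTr g < 1 ⇒ 2 ≤ 1 − reTr g`. [folklore] -/
theorem gap (g : Z2) (h : reTr g < 1) : (2 : ℝ) ≤ 1 - reTr g := by
  change tr g < 1 at h
  change (2 : ℝ) ≤ 1 - tr g
  rcases eq_one_or g with ⟨-, hg⟩ | hg
  · rw [hg] at h; norm_num at h
  · rw [hg]; norm_num

/-- `|Z2| = 2`. [folklore] -/
theorem card_eq : Fintype.card Z2 = 2 := Fintype.card_units_int

/-- The discrete measurable structure. [folklore] -/
instance : MeasurableSpace Z2 := ⊤
/-- Every singleton is measurable (discrete structure). [folklore] -/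
instance : MeasurableSingletonClass Z2 := ⟨fun _ => MeasurableSpace.measurableSet_top⟩
/-- Multiplication is measurable (finite discrete space). [folklore] -/
instance : MeasurableMul₂ Z2 := ⟨measurable_of_finite _⟩
/-- Inversion is measurable (finite discrete space). [folklore] -/
instance : MeasurableInv Z2 := ⟨measurable_of_finite _⟩

/-- `Z2` is a `RegularGaugeGroup` (everything is measurable on a finite discrete space; `|tr| ≤ 1`). [folklore] -/
instance : RegularGaugeGroup Z2 where
  measurable_dist1 := measurable_of_finite _
  measurable_reTr := measurable_of_finite _
  abs_reTr_le_one := abs_tr_le_one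

/-- The uniform probability measure `½·(counting measure)`. [folklore] -/
def unif : Measure Z2 := (2 : ℝ≥0∞)⁻¹ • Measure.count

/-- Every singleton has mass `½`. [folklore] -/
theorem unif_singleton (a : Z2) : unif {a} = (2 : ℝ≥0∞)⁻¹ := by
  rw [unif, Measure.smul_apply, Measure.count_singleton, smul_eq_mul, mul_one]

/-- A measure on `Z2` giving mass `½` to both singletons is `unif`. [folklore] -/
theorem eq_unif_of_singleton {μ : Measure Z2} (h : ∀ a, μ {a} = (2 : ℝ≥0∞)⁻¹) : μ = unif :=
  Measure.ext_iff_singleton.mpr fun a => by rw [h a, unif_singleton]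

/-- `Z2` carries the uniform measure as `HaarData` (probability, left∕right∕inversion invariant). [folklore] -/
instance : HaarData Z2 where
  haar := unif
  isProb := ⟨by
    rw [unif, Measure.smul_apply, ← Finset.coe_univ, Measure.count_apply_finset, Finset.card_univ, card_eq, smul_eq_mul]
    norm_num
    exact ENNReal.inv_mul_cancel (by norm_num) (by norm_num)⟩
  map_mul_left g := eq_unif_of_singleton fun a => by
    rw [Measure.map_apply (measurable_of_finite _) (measurableSet_singleton a), Set.preimage_mul_left_singleton,
      unif_singleton]
  map_mul_right g := eq_unif_of_singleton fun a => by
    rw [Measure.map_apply (measurable_of_finite _) (measurableSet_singleton a), Set.preimage_mul_right_singleton,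
      unif_singleton]
  map_inv := eq_unif_of_singleton fun a => by
    rw [Measure.map_apply (measurable_of_finite _) (measurableSet_singleton a)]
    have : (fun h : Z2 => h⁻¹) ⁻¹' {a} = {a⁻¹} := by
      ext h
      simp only [Set.mem_preimage, Set.mem_singleton_iff]
      exact inv_eq_iff_eq_inv
    rw [this, unif_singleton]

end Z2

/-! ## §2 The plaquette scheme on the `d = 4` tori and the frozen couplings -/

section Plaquette

/-- The `d = 4` tori `params4 L m K` have `2L^{m+K} → ∞` sites per direction. [folklore] -/
theorem sitesPerDir_params4_tendsto (L : ℕ) (hL : Odd L ∧ 1 < L) (m : ℕ) :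
    Tendsto (fun K => (params4 L hL m K).sitesPerDir 0) atTop atTop := by
  refine tendsto_atTop_mono (fun K => ?_) tendsto_id
  show K ≤ 2 * L ^ (m + K - 0)
  rw [Nat.sub_zero]
  calc K ≤ L ^ K := (Nat.lt_pow_self hL.2).le
    _ ≤ L ^ (m + K) := Nat.pow_le_pow_right (by omega) (by omega)
    _ ≤ 2 * L ^ (m + K) := by omega


variable (G : Type*) [GaugeGroup G]

/-- THE PLAQUETTE SCHEME on the `d = 4` tori `params4 L m K` at inverse couplings `β`: labels `o : O` name plaquettes
`pl K o` of the `K`-th torus, observables = the plaquette variables `Re tr U(∂p)` (the `1 × 1` Wilson loops; gauge invariant,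
bounded by `1`).  Defined for every gauge group. [folklore] -/
def plaquetteScheme (L : ℕ) (hL : Odd L ∧ 1 < L) (m : ℕ) (β : ℕ → ℝ) {O : Type*}
    (pl : (K : ℕ) → O → Plaq (params4 L hL m K) 0) : TorusScheme G O where
  P K := params4 L hL m K
  sites_tendsto := sitesPerDir_params4_tendsto L hL m
  β := β
  obs K o U := reTr (GaugeField.plaqHol U (pl K o))

variable {G}


/-- Plaquette variables are bounded by `1` on a regular gauge group. [folklore] -/
theorem plaquetteScheme_abs_le [MeasurableSpace G] [RegularGaugeGroup G] (L : ℕ) (hL : Odd L ∧ 1 < L) (m : ℕ)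
    (β : ℕ → ℝ) {O : Type*} (pl : (K : ℕ) → O → Plaq (params4 L hL m K) 0) (K : ℕ) (o : O)
    (U : GaugeField (params4 L hL m K) 0 G) : |(plaquetteScheme G L hL m β pl).obs K o U| ≤ 1 :=
  RegularGaugeGroup.abs_reTr_le_one _

/-- The scheme's couplings are the given ones (definitional). [folklore] -/
theorem plaquetteScheme_beta_nonneg (L : ℕ) (hL : Odd L ∧ 1 < L) (m : ℕ) {β : ℕ → ℝ} (hβ : ∀ K, 0 ≤ β K) {O : Type*}
    (pl : (K : ℕ) → O → Plaq (params4 L hL m K) 0) (K : ℕ) : 0 ≤ (plaquetteScheme G L hL m β pl).β K :=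
  hβ K

/-- FROZEN COUPLINGS: `β_K := n_K + K`, `n_K` the number of positively oriented bonds of the `K`-th torus. [folklore] -/
def frozenBeta (L : ℕ) (hL : Odd L ∧ 1 < L) (m : ℕ) (K : ℕ) : ℝ :=
  (Fintype.card (PBond (params4 L hL m K) 0) : ℝ) + K

/-- The frozen couplings are nonnegative. [folklore] -/
theorem frozenBeta_nonneg (L : ℕ) (hL : Odd L ∧ 1 < L) (m : ℕ) (K : ℕ) : 0 ≤ frozenBeta L hL m K := by
  unfold frozenBeta; positivity


end Plaquette

end Summit.QuantumFields.BalabanUV.T4Continuum.NE7ApexFrozenDefs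

end
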